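import Summits.AtomisticToContinuum.HydrodynamicLimit.Theses.EulerCharacteristics
import Summits.AtomisticToContinuum.HydrodynamicLimit.Theses.SuperextensiveClosureCost
import Summits.AtomisticToContinuum.HydrodynamicLimit.Theorems.JParityClosureDensityCapMeanDisplacement
import HarnessLib.Audit

/-!
# Birth skeleton — crux `NoDenseInclusions` (stmt-AtomisticToContinuum-14425)

Routes: `EulerCharacteristics` (rank 4, consumed by `FKTransferInProbR` at `η₁ := η₀(cell)`) and
`SuperextensiveClosureCost` (rank 4) — ONE shared item, the two route decls are the same term
(`noDenseInclusions_shared_iff` below is `Iff.rfl`).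

THE CRUX (fixed, never restated): along the non-equilibrium deterministic hard-sphere flow from local
Gibbs data tied at `t = 0` to a classical hs-Euler solution whose reduced density stays `≤ η₁/2` on
`[0,t] × 𝕋³`, the local Gibbs probability that SOME ball of the mesoscopic radius `ℓ_N = (N+1)^{-1/4}`
is over-packed (`ρ^ℓ σ³ > η₁`) at SOME time `r ∈ [0,t]` tends to `0`.

## The line: COUNTING CLOCK + FIXED-TIME MESOSCOPIC PACKING LD

The sup over the time CONTINUUM at a VANISHING radius is the one piece of the crux that is pure
kinematics; everything statistical is a FIXED-TIME statement. The cut: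

* `stub_clockInclusion` (A, sure, one flow, any radius `ℓ`, size M; provable now): along a good orbit
  with kinetic energy per particle `≤ K`, between two times `Δ` apart at most `10·n·√(2K)·Δ/ℓ`
  particles move farther than `ℓ/10` (Markov on the LANDED mean-displacement clock
  `Theorems.stub_meanDisplacement`: `n⁻¹ ∑ᵢ d(xᵢ(r), xᵢ(s)) ≤ √(2K̄)|r − s|`), so a ball of radius `ℓ`
  over-packed at level `c` at time `r` leaves the concentric ball of radius `(11/10)ℓ` over-packed at
  level `(2/3)c` at the nearest grid time `s`, `|r − s| ≤ Δ`, as soon as `25·Δ·√(2K) ≤ c·ℓ⁴`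
  (`1 − (2/3)(11/10)³ = 169/1500` and `(169/1500)·(4π/3)/10 > 1/25`). With `ℓ = ℓ_N` the mesh is
  `Δ_N ≍ (N+1)⁻¹`: polynomially many grid times.
* `stub_fixedTimePackingLD` (B, THE HEART, open): under the crux's own prefix (tie at `t = 0`, PDE band
  `ρσ³ ≤ η₁/2` on `[0,t]`), for every `k`, eventually in `N`, UNIFORMLY IN THE FIXED TIME `r ∈ [0,t]`:
  `LG_N{∃ x, ρ^{(11/10)ℓ_N}(r,x) σ³ > (2/3)η₁} ≤ (N+1)^{-k}` — a fixed-time large-deviation bound for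
  the ball count of `≍ N^{1/4}` spheres at `4/3` times the maximal Euler mean (expected true rate
  `e^{-cN^{1/4}}`; true at `r = 0` by a canonical Chernoff bound, true on the equilibrium flow by
  stationarity + static LD; along the non-equilibrium flow it is exactly the open a-priori content of
  the crux, now freed of the time continuum and asked with a super-polynomial rate).
* `gridUpgrade` (PROVED here, measure theory only): time net of mesh `Δ_N = c/((25√(2K)+1)(N+1))` in
  `[0,t]` (`≤ t/Δ_N + 1` points), bad set null, energy tightness, finite union bound, squeeze.
* `energyTight_of_tie` (PROVED here): the `χ ≡ 1` energy instance of the tie + conservation-free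
  bookkeeping (`Φ_0 = id` on the good set) gives `LG_N{K̄_N > ∫E(0) + 1} → 0`.

Composition (kernel-checked, no `sorry` in its own cone):
`noDenseInclusions_of_hyps : (stub A statement) → (stub B statement) →
EulerCharacteristics.NoDenseInclusions ∧ SuperextensiveClosureCost.NoDenseInclusions`, and the SKELETON
THEOREM `NoDenseInclusions_of : EulerCharacteristics.NoDenseInclusions` (by name, no hypotheses = the
composition applied to the two stubs; its sorries are exactly the stubs; `ledger skeleton check` ok),
plus `noDenseInclusions_shared_of` for the `SuperextensiveClosureCost` twin.

Why the cut is honest (not a costume): stub B is NOT the crux reworded — it has no time sup inside the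
probability (the continuum `r ∈ [0,t]` is discharged by stub A + `gridUpgrade` at mesh `N⁻¹`, which is
why B must carry a rate, and a polynomial one suffices), it lives at radius `(11/10)ℓ_N` and level
`(2/3)η₁`; neither `B → crux` nor `crux → B` is a one-liner (BC3 probes recorded in the line card).
Stub A is a sure kinematic lemma about ONE flow and any radius; it knows nothing about Gibbs laws.

Disproof.lean: none exists for this crux yet (no cdisprove cycle); negatives index 2026-08-17: no
refuted statement concerns mesoscopic packing (9168's untied-constant-state witness does not bite:
B keeps the tie and the PDE band; 14607's static cubic-tail witness is about exponential currency for
single-sphere tails — B asks a polynomial rate for an `N^{1/4}`-particle event, Chernoff-true at r = 0).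
-/

noncomputable section

namespace Summit.AtomisticToContinuum.HydrodynamicLimit.Cruxes.NoDenseInclusions.Birth

open MeasureTheory Filter Set Topology
open scoped ENNReal BigOperators
open Literature.MathematicalPhysics.KineticTheory Literature.Analysis.FluidPDE

/-! ## §0 The two route decls are one term -/

/-- The shared item: `SuperextensiveClosureCost.NoDenseInclusions` and
`EulerCharacteristics.NoDenseInclusions` are syntactically the same proposition. -/
theorem noDenseInclusions_shared_iff :
    Theses.SuperextensiveClosureCost.NoDenseInclusions ↔ Theses.EulerCharacteristics.NoDenseInclusions :=
  Iff.rfl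

/-! ## §1 Registered stubs -/

/-- **STUB A — the counting clock (sure inclusion; one flow, any radius; size M, provable now).**
For ONE hard-sphere flow `Ψ` on `𝕋³` (`n` spheres, any diameter), a horizon `t`, an energy level `K`,
a radius `ℓ > 0`, a level `c > 0`, a mesh `Δ > 0` with `25·Δ·√(2K) ≤ c·ℓ⁴`, and ANY finite set of
times `St` that is `Δ`-dense in `[0,t]`: every GOOD initial datum with kinetic energy per particle
`n⁻¹·configEnergy ≤ K` whose orbit has, at some time `r ∈ [0,t]`, some ball of radius `ℓ` with
sharp-kernel empirical density `> c`, has at some grid time `s ∈ St` some ball of radius `(11/10)ℓ`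
with empirical density `> (2/3)c`.
Proof route: `empiricalDensityField w (ball kernel) = #{i : d(x, wᵢ) < ℓ} / (n · 4πℓ³/3)`
(`integral_empiricalMeasure`); pick `s ∈ St` with `|r − s| ≤ Δ`; by the landed clock
`Theorems.stub_meanDisplacement` (`n⁻¹∑ᵢ d(xᵢ(r), xᵢ(s)) ≤ √(2K̄)|r−s| ≤ √(2K)Δ`) and Markov, at most
`10 n √(2K) Δ/ℓ` particles move `≥ ℓ/10`; the others that were in `ball(x,ℓ)` at time `r` are in
`ball(x,(11/10)ℓ)` at time `s` (`Torus.euclidDist_triangle`, `euclidDist_comm`); count: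
`c·n·V − 10n√(2K)Δ/ℓ ≥ (2/3)·c·n·(11/10)³·V` iff `√(2K)Δ ≤ (169/1500)(4π/30)·c·ℓ⁴`, implied by the
mesh hypothesis since `(169/1500)(4π/30) > 1/25`. Degenerate cases (`n = 0`, `K < 0`, `t < 0`) make
the left side empty. -/
theorem stub_clockInclusion {ε : ℝ} {n : ℕ} (Ψ : HardSphereFlow (Torus.geometry (Fin 3)) ε n)
    (t K ℓ c Δ : ℝ) (hℓ : 0 < ℓ) (hc : 0 < c) (hΔ : 0 < Δ)
    (hmesh : 25 * Δ * Real.sqrt (2 * K) ≤ c * ℓ ^ 4)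
    (St : Finset ℝ) (hSt : ∀ r ∈ Icc 0 t, ∃ s ∈ St, |r - s| ≤ Δ) :
    {z | ∃ r ∈ Icc 0 t, ∃ x : T3, c < empiricalDensityField (Ψ.flow r z)
        (fun y => if Torus.euclidDist x y < ℓ then (4 / 3 * Real.pi * ℓ ^ 3)⁻¹ else 0)} ∩ Ψ.good ∩
      {z | (n : ℝ)⁻¹ * configEnergy z ≤ K} ⊆
    ⋃ s ∈ St, {z | ∃ x : T3, 2 / 3 * c < empiricalDensityField (Ψ.flow s z)
        (fun y => if Torus.euclidDist x y < 11 / 10 * ℓ then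
          (4 / 3 * Real.pi * (11 / 10 * ℓ) ^ 3)⁻¹ else 0)} := by
  sorry

/-- **STUB B — fixed-time mesoscopic packing LD along the flow (THE HEART; open).**
Under the crux's prefix — continuous positive profiles, `σ < σ₀(η₁, profiles)`, a classical hs-Euler
solution on `[0,T)`, any flow family, local Gibbs data tied to the solution at `t = 0`, a horizon
`t < T` on which the PDE packing stays `ρ_r(x)σ³ ≤ η₁/2` — for every `k : ℕ`, eventually in `N`,
UNIFORMLY IN THE FIXED TIME `r ∈ [0,t]`: the local Gibbs probability that SOME ball of radius
`(11/10)·(N+1)^{-1/4}` has sharp-kernel empirical reduced density `> (2/3)η₁` at time `r` is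
`≤ (N+1)^{-k}`. (`4/3` times the maximal Euler mean on `≍ N^{1/4}` spheres; expected true rate
`exp(−c N^{1/4})`; true at `r = 0` (canonical Chernoff) and on the equilibrium flow (stationarity +
static LD). Any radius multiplier `κ > 1` and level `λ ∈ (1/2, 1)` with `λκ³ < 1` would serve the
composition; `(11/10, 2/3)` is fixed for definiteness.) -/
theorem stub_fixedTimePackingLD :
    ∀ η₁ : ℝ, 0 < η₁ → ∀ (a₀ θ₀ : T3 → ℝ) (u₀ : T3 → V3), Continuous a₀ → Continuous θ₀ →
      Continuous u₀ → (∀ x, 0 < a₀ x) → (∀ x, 0 < θ₀ x) →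
      ∃ σ₀ : ℝ, 0 < σ₀ ∧ ∀ σ : ℝ, 0 < σ → σ < σ₀ →
        ∀ (T : ℝ) (ρ θ : ℝ → T3 → ℝ) (u : ℝ → T3 → V3), IsHardSphereEulerSolution σ T ρ u θ →
          ∀ Φ : (N : ℕ) → HardSphereFlow (Torus.geometry (Fin 3)) (hsDiameter σ N) (N + 1),
            TendstoHydroFieldsAt (fun N => localGibbsLaw σ a₀ u₀ θ₀ N (Φ N)) Φ ρ u θ 0 →
              ∀ t ∈ Ico 0 T, (∀ r ∈ Icc 0 t, ∀ x, ρ r x * σ ^ 3 ≤ η₁ / 2) →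
                ∀ k : ℕ, ∀ᶠ N : ℕ in atTop, ∀ r ∈ Icc 0 t,
                  localGibbsLaw σ a₀ u₀ θ₀ N (Φ N) {z | ∃ x : T3, 2 / 3 * η₁ <
                    empiricalDensityField ((Φ N).flow r z)
                      (fun y => if Torus.euclidDist x y < 11 / 10 * ((N + 1 : ℕ) : ℝ) ^ (-(1 / 4 : ℝ)) then
                        (4 / 3 * Real.pi * (11 / 10 * ((N + 1 : ℕ) : ℝ) ^ (-(1 / 4 : ℝ))) ^ 3)⁻¹ else 0) *
                      σ ^ 3} ≤
                  ENNReal.ofReal ((((N + 1 : ℕ) : ℝ) ^ k)⁻¹) := by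
  sorry

/-! ## §2 Glue (sorry-free) -/

/-- Kinetic energy per particle = the empirical energy field tested against `χ ≡ 1`. -/
theorem kinEnergy_eq_empiricalEnergyField {n : ℕ} (w : Config n (Fin 3) T3) :
    (n : ℝ)⁻¹ * configEnergy w = empiricalEnergyField w (fun _ => 1) := by
  unfold empiricalEnergyField configEnergy
  rw [integral_empiricalMeasure]
  congr 1
  rw [Finset.mul_sum]
  refine Finset.sum_congr rfl fun i _ => ?_
  ring

/-- The bad set of a flow is null for the local Gibbs law (absolutely continuous w.r.t. Liouville). -/
theorem localGibbsLaw_compl_good (σ : ℝ) (a₀ θ₀ : T3 → ℝ) (u₀ : T3 → V3) (N : ℕ)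
    (Ψ : HardSphereFlow (Torus.geometry (Fin 3)) (hsDiameter σ N) (N + 1)) :
    localGibbsLaw σ a₀ u₀ θ₀ N Ψ Ψ.goodᶜ = 0 := by
  have hL : localGibbsLaw σ a₀ u₀ θ₀ N Ψ =
      (liouville (Torus.geometry (Fin 3)) (N + 1) (hsDiameter σ N)).withDensity fun z => ENNReal.ofReal
        (canonicalDensity (Torus.geometry (Fin 3)) (hsDiameter σ N) (N + 1) (localGibbsProfile a₀ u₀ θ₀) z) :=
    rfl
  rw [hL]
  exact withDensity_absolutelyContinuous _ _ Ψ.measure_compl_good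

/-- **Energy tightness from the tie**: the `χ ≡ 1` energy instance of the `t = 0` law of large
numbers — the kinetic energy per particle exceeds `∫ E(0) + 1` only with vanishing probability
(on the good set `Φ_0 = id`; the bad set is null). -/
theorem energyTight_of_tie {σ : ℝ} {a₀ θ₀ : T3 → ℝ} {u₀ : T3 → V3} {ρ θ : ℝ → T3 → ℝ}
    {u : ℝ → T3 → V3}
    (Φ : (N : ℕ) → HardSphereFlow (Torus.geometry (Fin 3)) (hsDiameter σ N) (N + 1))
    (h0 : TendstoHydroFieldsAt (fun N => localGibbsLaw σ a₀ u₀ θ₀ N (Φ N)) Φ ρ u θ 0) :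
    Tendsto (fun N => localGibbsLaw σ a₀ u₀ θ₀ N (Φ N)
      {z | (∫ x, totalEnergyDensity (ρ 0 x) (u 0 x) (θ 0 x)) + 1 <
        ((N + 1 : ℕ) : ℝ)⁻¹ * configEnergy z}) atTop (𝓝 0) := by
  set E₀ : ℝ := ∫ x, totalEnergyDensity (ρ 0 x) (u 0 x) (θ 0 x) with hE₀
  have h := (h0 (fun _ => (1 : ℝ)) continuous_const 1 one_pos).2.2
  have hE : (∫ x, (fun _ : T3 => (1 : ℝ)) x * totalEnergyDensity (ρ 0 x) (u 0 x) (θ 0 x)) = E₀ := by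
    simp only [one_mul, hE₀]
  refine tendsto_of_tendsto_of_tendsto_of_le_of_le tendsto_const_nhds h (fun _ => zero_le) fun N => ?_
  set P := localGibbsLaw σ a₀ u₀ θ₀ N (Φ N) with hP
  have hsub : {z : Config (N + 1) (Fin 3) T3 | E₀ + 1 < ((N + 1 : ℕ) : ℝ)⁻¹ * configEnergy z} ⊆
      ({z | E₀ + 1 < ((N + 1 : ℕ) : ℝ)⁻¹ * configEnergy z} ∩ (Φ N).good) ∪ (Φ N).goodᶜ := by
    intro z hz
    by_cases hg : z ∈ (Φ N).good
    · exact Or.inl ⟨hz, hg⟩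
    · exact Or.inr hg
  have hincl : {z : Config (N + 1) (Fin 3) T3 | E₀ + 1 < ((N + 1 : ℕ) : ℝ)⁻¹ * configEnergy z} ∩
      (Φ N).good ⊆
      {z | (1 : ℝ) < |empiricalEnergyField ((Φ N).flow 0 z) (fun _ => (1 : ℝ)) -
        ∫ x, (fun _ : T3 => (1 : ℝ)) x * totalEnergyDensity (ρ 0 x) (u 0 x) (θ 0 x)|} := by
    rintro z ⟨hz, hg⟩
    have hz' : E₀ + 1 < ((N + 1 : ℕ) : ℝ)⁻¹ * configEnergy z := hz
    show (1 : ℝ) < |empiricalEnergyField ((Φ N).flow 0 z) (fun _ => (1 : ℝ)) -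
        ∫ x, (fun _ : T3 => (1 : ℝ)) x * totalEnergyDensity (ρ 0 x) (u 0 x) (θ 0 x)|
    rw [(Φ N).flow_zero z hg, ← kinEnergy_eq_empiricalEnergyField, hE]
    exact lt_of_lt_of_le (by linarith) (le_abs_self _)
  calc P {z | E₀ + 1 < ((N + 1 : ℕ) : ℝ)⁻¹ * configEnergy z}
      ≤ P ({z | E₀ + 1 < ((N + 1 : ℕ) : ℝ)⁻¹ * configEnergy z} ∩ (Φ N).good) + P (Φ N).goodᶜ :=
        (measure_mono hsub).trans (measure_union_le _ _)
    _ ≤ P {z | (1 : ℝ) < |empiricalEnergyField ((Φ N).flow 0 z) (fun _ => (1 : ℝ)) -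
          ∫ x, (fun _ : T3 => (1 : ℝ)) x * totalEnergyDensity (ρ 0 x) (u 0 x) (θ 0 x)|} + 0 :=
        add_le_add (measure_mono hincl) (le_of_eq (localGibbsLaw_compl_good σ a₀ θ₀ u₀ N (Φ N)))
    _ = _ := add_zero _

/-- `ℓ_N⁴ = (N+1)⁻¹`. -/
theorem radius_pow_four (N : ℕ) :
    (((N + 1 : ℕ) : ℝ) ^ (-(1 / 4 : ℝ))) ^ 4 = ((N + 1 : ℕ) : ℝ)⁻¹ := by
  have hN : (0 : ℝ) < ((N + 1 : ℕ) : ℝ) := by positivity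
  rw [← Real.rpow_natCast, ← Real.rpow_mul hN.le]
  norm_num
  exact Real.rpow_neg_one _

/-- **The grid upgrade (PROVED; measure theory + a time net).** For abstract per-`N` events `A N`
(the crux event) and `B N s` (the fixed-time events): if a sure inclusion of the clock type holds for
EVERY admissible mesh `Δ` and every `Δ`-dense finite time set (stub A's shape, level `c`), the kinetic
energy per particle is tight at level `K`, and the fixed-time events have probability
`≤ (N+1)^{-2}` uniformly in `s ∈ [0,t]` eventually (stub B's shape at `k = 2`), then
`P_N(A N) → 0`: choose `Δ_N := c/((25√(2K)+1)(N+1))`, the net `{jΔ_N : j ≤ ⌊t/Δ_N⌋}` of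
`≤ t/Δ_N + 1 = O(N+1)` points, discard the null bad set and the energy-atypical set, union bound. -/
theorem gridUpgrade {σ : ℝ} (a₀ θ₀ : T3 → ℝ) (u₀ : T3 → V3)
    (Φ : (N : ℕ) → HardSphereFlow (Torus.geometry (Fin 3)) (hsDiameter σ N) (N + 1))
    (A : (N : ℕ) → Set (Config (N + 1) (Fin 3) T3))
    (B : (N : ℕ) → ℝ → Set (Config (N + 1) (Fin 3) T3))
    {t c K : ℝ} (ht : 0 ≤ t) (hc : 0 < c)
    (hK : Tendsto (fun N => localGibbsLaw σ a₀ u₀ θ₀ N (Φ N)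
      {z | K < ((N + 1 : ℕ) : ℝ)⁻¹ * configEnergy z}) atTop (𝓝 0))
    (hincl : ∀ (N : ℕ) (Δ : ℝ), 0 < Δ →
      25 * Δ * Real.sqrt (2 * K) ≤ c * (((N + 1 : ℕ) : ℝ) ^ (-(1 / 4 : ℝ))) ^ 4 →
      ∀ St : Finset ℝ, (∀ r ∈ Icc 0 t, ∃ s ∈ St, |r - s| ≤ Δ) →
        A N ∩ (Φ N).good ∩ {z | ((N + 1 : ℕ) : ℝ)⁻¹ * configEnergy z ≤ K} ⊆ ⋃ s ∈ St, B N s)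
    (hpt : ∀ᶠ N : ℕ in atTop, ∀ s ∈ Icc 0 t,
      localGibbsLaw σ a₀ u₀ θ₀ N (Φ N) (B N s) ≤ ENNReal.ofReal ((((N + 1 : ℕ) : ℝ) ^ 2)⁻¹)) :
    Tendsto (fun N => localGibbsLaw σ a₀ u₀ θ₀ N (Φ N) (A N)) atTop (𝓝 0) := by
  classical
  -- the mesh constant `L = 25√(2K) + 1`
  set L : ℝ := 25 * Real.sqrt (2 * K) + 1 with hL
  have hLpos : 0 < L := by
    have hs : 0 ≤ Real.sqrt (2 * K) := Real.sqrt_nonneg _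
    rw [hL]; linarith
  -- per `N`: the time net of mesh `Δ_N := c/(L(N+1))`, its size, and the sure inclusion
  have key : ∀ N : ℕ, ∃ St : Finset ℝ, (∀ s ∈ St, s ∈ Icc 0 t) ∧
      ((St.card : ℝ) ≤ t * (L * ((N + 1 : ℕ) : ℝ)) / c + 1) ∧
      A N ∩ (Φ N).good ∩ {z | ((N + 1 : ℕ) : ℝ)⁻¹ * configEnergy z ≤ K} ⊆ ⋃ s ∈ St, B N s := by
    intro N
    have hN : (0 : ℝ) < ((N + 1 : ℕ) : ℝ) := by positivity
    set Δ : ℝ := c / (L * ((N + 1 : ℕ) : ℝ)) with hΔ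
    have hΔpos : 0 < Δ := by rw [hΔ]; exact div_pos hc (mul_pos hLpos hN)
    have hΔL : Δ * L = c * ((N + 1 : ℕ) : ℝ)⁻¹ := by
      rw [hΔ]
      field_simp
    have hmesh : 25 * Δ * Real.sqrt (2 * K) ≤ c * (((N + 1 : ℕ) : ℝ) ^ (-(1 / 4 : ℝ))) ^ 4 := by
      rw [radius_pow_four, ← hΔL]
      have hs : 0 ≤ Real.sqrt (2 * K) := Real.sqrt_nonneg _
      calc 25 * Δ * Real.sqrt (2 * K) = Δ * (25 * Real.sqrt (2 * K)) := by ring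
        _ ≤ Δ * L := by
            refine mul_le_mul_of_nonneg_left ?_ hΔpos.le
            rw [hL]; linarith
    set M : ℕ := ⌊t / Δ⌋₊ with hM
    have hMle : (M : ℝ) ≤ t / Δ := Nat.floor_le (div_nonneg ht hΔpos.le)
    refine ⟨(Finset.range (M + 1)).image (fun j : ℕ => (j : ℝ) * Δ), ?_, ?_, ?_⟩
    · intro s hs
      obtain ⟨j, hj, rfl⟩ := Finset.mem_image.1 hs
      have hj' : j ≤ M := Nat.lt_succ_iff.1 (Finset.mem_range.1 hj)
      have hjM : (j : ℝ) ≤ (M : ℝ) := by exact_mod_cast hj'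
      refine ⟨mul_nonneg (Nat.cast_nonneg _) hΔpos.le, ?_⟩
      calc (j : ℝ) * Δ ≤ (M : ℝ) * Δ := mul_le_mul_of_nonneg_right hjM hΔpos.le
        _ ≤ t / Δ * Δ := mul_le_mul_of_nonneg_right hMle hΔpos.le
        _ = t := div_mul_cancel₀ t hΔpos.ne'
    · calc (((Finset.range (M + 1)).image (fun j : ℕ => (j : ℝ) * Δ)).card : ℝ)
          ≤ ((Finset.range (M + 1)).card : ℝ) := by exact_mod_cast Finset.card_image_le
        _ = (M : ℝ) + 1 := by rw [Finset.card_range]; push_cast; ring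
        _ ≤ t / Δ + 1 := by linarith
        _ = t * (L * ((N + 1 : ℕ) : ℝ)) / c + 1 := by rw [hΔ, div_div_eq_mul_div]
    · refine hincl N Δ hΔpos hmesh _ ?_
      intro r hr
      refine ⟨(⌊r / Δ⌋₊ : ℝ) * Δ, ?_, ?_⟩
      · refine Finset.mem_image.2 ⟨⌊r / Δ⌋₊, Finset.mem_range.2 (Nat.lt_succ_of_le ?_), rfl⟩
        exact Nat.floor_mono (div_le_div_of_nonneg_right hr.2 hΔpos.le)
      · have h1 : (⌊r / Δ⌋₊ : ℝ) ≤ r / Δ := Nat.floor_le (div_nonneg hr.1 hΔpos.le)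
        have h2 : r / Δ < (⌊r / Δ⌋₊ : ℝ) + 1 := Nat.lt_floor_add_one (r / Δ)
        have h1' : (⌊r / Δ⌋₊ : ℝ) * Δ ≤ r := by
          calc (⌊r / Δ⌋₊ : ℝ) * Δ ≤ r / Δ * Δ := mul_le_mul_of_nonneg_right h1 hΔpos.le
            _ = r := div_mul_cancel₀ r hΔpos.ne'
        have h2' : r < (⌊r / Δ⌋₊ : ℝ) * Δ + Δ := by
          have := mul_lt_mul_of_pos_right h2 hΔpos
          rw [div_mul_cancel₀ r hΔpos.ne', add_mul, one_mul] at this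
          exact this
        rw [abs_le]
        constructor <;> linarith
  choose St hSt_mem hSt_card hSt_incl using key
  have hbad : ∀ N, localGibbsLaw σ a₀ u₀ θ₀ N (Φ N) (Φ N).goodᶜ = 0 :=
    fun N => localGibbsLaw_compl_good σ a₀ θ₀ u₀ N (Φ N)
  -- the real majorant `g N = (#net bound) · (N+1)⁻²`
  set g : ℕ → ℝ := fun N => (t * (L * ((N + 1 : ℕ) : ℝ)) / c + 1) * (((N + 1 : ℕ) : ℝ) ^ 2)⁻¹ with hg
  have hg_tendsto : Tendsto g atTop (𝓝 0) := by
    have hup : Tendsto (fun N : ℕ => (t * L / c + 1) * (1 / ((N : ℝ) + 1))) atTop (𝓝 0) := by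
      simpa using (tendsto_one_div_add_atTop_nhds_zero_nat).const_mul (t * L / c + 1)
    refine tendsto_of_tendsto_of_tendsto_of_le_of_le tendsto_const_nhds hup (fun N => ?_) (fun N => ?_)
    · show (0 : ℝ) ≤ (t * (L * ((N + 1 : ℕ) : ℝ)) / c + 1) * (((N + 1 : ℕ) : ℝ) ^ 2)⁻¹
      have hN : (0 : ℝ) < ((N + 1 : ℕ) : ℝ) := by positivity
      have h1 : 0 ≤ t * (L * ((N + 1 : ℕ) : ℝ)) / c := div_nonneg (mul_nonneg ht (mul_nonneg hLpos.le hN.le)) hc.le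
      have h2 : 0 ≤ (((N + 1 : ℕ) : ℝ) ^ 2)⁻¹ := inv_nonneg.2 (pow_nonneg hN.le 2)
      exact mul_nonneg (by linarith) h2
    · show (t * (L * ((N + 1 : ℕ) : ℝ)) / c + 1) * (((N + 1 : ℕ) : ℝ) ^ 2)⁻¹ ≤ (t * L / c + 1) * (1 / ((N : ℝ) + 1))
      have hN : (0 : ℝ) < ((N + 1 : ℕ) : ℝ) := by positivity
      have hn0 : ((N + 1 : ℕ) : ℝ) ≠ 0 := hN.ne'
      have hc0 : c ≠ 0 := hc.ne'
      have hcast : ((N + 1 : ℕ) : ℝ) = (N : ℝ) + 1 := by push_cast; ring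
      have h1n : ((N + 1 : ℕ) : ℝ)⁻¹ ≤ 1 := by
        refine inv_le_one_of_one_le₀ ?_
        exact_mod_cast Nat.succ_le_succ (Nat.zero_le N)
      have htl : 0 ≤ t * L / c := div_nonneg (mul_nonneg ht hLpos.le) hc.le
      calc (t * (L * ((N + 1 : ℕ) : ℝ)) / c + 1) * (((N + 1 : ℕ) : ℝ) ^ 2)⁻¹
          = (t * L / c + ((N + 1 : ℕ) : ℝ)⁻¹) * ((N + 1 : ℕ) : ℝ)⁻¹ := by
            field_simp
        _ ≤ (t * L / c + 1) * ((N + 1 : ℕ) : ℝ)⁻¹ := by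
            refine mul_le_mul_of_nonneg_right ?_ (inv_nonneg.2 hN.le)
            linarith
        _ = (t * L / c + 1) * (1 / ((N : ℝ) + 1)) := by rw [one_div, hcast]
  -- the union bound, eventually in `N`
  have hmain : ∀ᶠ N : ℕ in atTop, localGibbsLaw σ a₀ u₀ θ₀ N (Φ N) (A N) ≤
      localGibbsLaw σ a₀ u₀ θ₀ N (Φ N) {z | K < ((N + 1 : ℕ) : ℝ)⁻¹ * configEnergy z} +
        ENNReal.ofReal (g N) := by
    filter_upwards [hpt] with N hN
    set P := localGibbsLaw σ a₀ u₀ θ₀ N (Φ N) with hP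
    have hsub : A N ⊆ (A N ∩ (Φ N).good ∩ {z | ((N + 1 : ℕ) : ℝ)⁻¹ * configEnergy z ≤ K} ∪
        (Φ N).goodᶜ) ∪ {z | K < ((N + 1 : ℕ) : ℝ)⁻¹ * configEnergy z} := by
      intro z hz
      by_cases hgood : z ∈ (Φ N).good
      · by_cases hk : ((N + 1 : ℕ) : ℝ)⁻¹ * configEnergy z ≤ K
        · exact Or.inl (Or.inl ⟨⟨hz, hgood⟩, hk⟩)
        · exact Or.inr (lt_of_not_ge hk)
      · exact Or.inl (Or.inr hgood)
    have hsum : ∑ s ∈ St N, P (B N s) ≤ ∑ s ∈ St N, ENNReal.ofReal ((((N + 1 : ℕ) : ℝ) ^ 2)⁻¹) :=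
      Finset.sum_le_sum fun s hs => hN s (hSt_mem N s hs)
    have hcard : ((St N).card : ℝ≥0∞) * ENNReal.ofReal ((((N + 1 : ℕ) : ℝ) ^ 2)⁻¹) ≤
        ENNReal.ofReal (g N) := by
      rw [← ENNReal.ofReal_natCast, ← ENNReal.ofReal_mul (Nat.cast_nonneg _), hg]
      exact ENNReal.ofReal_le_ofReal (mul_le_mul_of_nonneg_right (hSt_card N)
        (inv_nonneg.2 (pow_nonneg (Nat.cast_nonneg _) 2)))
    calc P (A N) ≤ P ((A N ∩ (Φ N).good ∩ {z | ((N + 1 : ℕ) : ℝ)⁻¹ * configEnergy z ≤ K} ∪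
          (Φ N).goodᶜ)) + P {z | K < ((N + 1 : ℕ) : ℝ)⁻¹ * configEnergy z} :=
          (measure_mono hsub).trans (measure_union_le _ _)
      _ ≤ (P (A N ∩ (Φ N).good ∩ {z | ((N + 1 : ℕ) : ℝ)⁻¹ * configEnergy z ≤ K}) + P (Φ N).goodᶜ) +
          P {z | K < ((N + 1 : ℕ) : ℝ)⁻¹ * configEnergy z} :=
          add_le_add (measure_union_le _ _) le_rfl
      _ ≤ (P (⋃ s ∈ St N, B N s) + 0) + P {z | K < ((N + 1 : ℕ) : ℝ)⁻¹ * configEnergy z} :=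
          add_le_add (add_le_add (measure_mono (hSt_incl N)) (hbad N).le) le_rfl
      _ ≤ (∑ s ∈ St N, P (B N s)) + P {z | K < ((N + 1 : ℕ) : ℝ)⁻¹ * configEnergy z} := by
          rw [add_zero]
          exact add_le_add (measure_biUnion_finset_le _ _) le_rfl
      _ ≤ ((St N).card : ℝ≥0∞) * ENNReal.ofReal ((((N + 1 : ℕ) : ℝ) ^ 2)⁻¹) +
          P {z | K < ((N + 1 : ℕ) : ℝ)⁻¹ * configEnergy z} := by
          refine add_le_add (hsum.trans ?_) le_rfl
          rw [Finset.sum_const, nsmul_eq_mul]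
      _ ≤ ENNReal.ofReal (g N) + P {z | K < ((N + 1 : ℕ) : ℝ)⁻¹ * configEnergy z} :=
          add_le_add hcard le_rfl
      _ = P {z | K < ((N + 1 : ℕ) : ℝ)⁻¹ * configEnergy z} + ENNReal.ofReal (g N) := add_comm _ _
  have hupper : Tendsto (fun N => localGibbsLaw σ a₀ u₀ θ₀ N (Φ N)
      {z | K < ((N + 1 : ℕ) : ℝ)⁻¹ * configEnergy z} + ENNReal.ofReal (g N)) atTop (𝓝 0) := by
    simpa using hK.add (ENNReal.tendsto_ofReal hg_tendsto)
  exact tendsto_of_tendsto_of_tendsto_of_le_of_le' tendsto_const_nhds hupper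
    (Eventually.of_forall fun N => zero_le) hmain

/-! ## §3 Composition (audited): stubs A and B give the crux BY NAME -/

/-- **The composition with explicit hypotheses** (kernel-checked, no `sorry` in its cone): from the
STATEMENT of stub A (`hA`) and the STATEMENT of stub B (`hB`) to BOTH route decls of the shared crux
(stated as a conjunction so that the hypothesis-free `NoDenseInclusions_of` / `noDenseInclusions_shared_of`
below are the only theorems concluding a route decl by name — skeleton audit (i)/(ii)): `σ₀` from `hB`;
for a tied classical solution, `t < T` and the PDE band, energy tightness from the tie
(`energyTight_of_tie`), `hA` at radius `ℓ_N`, level `c := η₁/σ³` (the crux event rewritten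
`η₁ < ρ^ℓ σ³ ↔ η₁/σ³ < ρ^ℓ`), `hB` at `k := 2`, and `gridUpgrade`. -/
theorem noDenseInclusions_of_hyps
    (hA : ∀ {ε : ℝ} {n : ℕ} (Ψ : HardSphereFlow (Torus.geometry (Fin 3)) ε n)
      (t K ℓ c Δ : ℝ), 0 < ℓ → 0 < c → 0 < Δ → 25 * Δ * Real.sqrt (2 * K) ≤ c * ℓ ^ 4 →
      ∀ St : Finset ℝ, (∀ r ∈ Icc 0 t, ∃ s ∈ St, |r - s| ≤ Δ) →
      {z | ∃ r ∈ Icc 0 t, ∃ x : T3, c < empiricalDensityField (Ψ.flow r z)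
          (fun y => if Torus.euclidDist x y < ℓ then (4 / 3 * Real.pi * ℓ ^ 3)⁻¹ else 0)} ∩ Ψ.good ∩
        {z | (n : ℝ)⁻¹ * configEnergy z ≤ K} ⊆
      ⋃ s ∈ St, {z | ∃ x : T3, 2 / 3 * c < empiricalDensityField (Ψ.flow s z)
          (fun y => if Torus.euclidDist x y < 11 / 10 * ℓ then
            (4 / 3 * Real.pi * (11 / 10 * ℓ) ^ 3)⁻¹ else 0)})
    (hB : ∀ η₁ : ℝ, 0 < η₁ → ∀ (a₀ θ₀ : T3 → ℝ) (u₀ : T3 → V3), Continuous a₀ → Continuous θ₀ →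
      Continuous u₀ → (∀ x, 0 < a₀ x) → (∀ x, 0 < θ₀ x) →
      ∃ σ₀ : ℝ, 0 < σ₀ ∧ ∀ σ : ℝ, 0 < σ → σ < σ₀ →
        ∀ (T : ℝ) (ρ θ : ℝ → T3 → ℝ) (u : ℝ → T3 → V3), IsHardSphereEulerSolution σ T ρ u θ →
          ∀ Φ : (N : ℕ) → HardSphereFlow (Torus.geometry (Fin 3)) (hsDiameter σ N) (N + 1),
            TendstoHydroFieldsAt (fun N => localGibbsLaw σ a₀ u₀ θ₀ N (Φ N)) Φ ρ u θ 0 →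
              ∀ t ∈ Ico 0 T, (∀ r ∈ Icc 0 t, ∀ x, ρ r x * σ ^ 3 ≤ η₁ / 2) →
                ∀ k : ℕ, ∀ᶠ N : ℕ in atTop, ∀ r ∈ Icc 0 t,
                  localGibbsLaw σ a₀ u₀ θ₀ N (Φ N) {z | ∃ x : T3, 2 / 3 * η₁ <
                    empiricalDensityField ((Φ N).flow r z)
                      (fun y => if Torus.euclidDist x y < 11 / 10 * ((N + 1 : ℕ) : ℝ) ^ (-(1 / 4 : ℝ)) then
                        (4 / 3 * Real.pi * (11 / 10 * ((N + 1 : ℕ) : ℝ) ^ (-(1 / 4 : ℝ))) ^ 3)⁻¹ else 0) *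
                      σ ^ 3} ≤
                  ENNReal.ofReal ((((N + 1 : ℕ) : ℝ) ^ k)⁻¹)) :
    Theses.EulerCharacteristics.NoDenseInclusions ∧ Theses.SuperextensiveClosureCost.NoDenseInclusions := by
  suffices h : Theses.EulerCharacteristics.NoDenseInclusions from ⟨h, noDenseInclusions_shared_iff.2 h⟩
  intro η₁ hη₁ a₀ θ₀ u₀ ha hθ hu ha0 hθ0
  obtain ⟨σ₀, hσ₀, H⟩ := hB η₁ hη₁ a₀ θ₀ u₀ ha hθ hu ha0 hθ0
  refine ⟨σ₀, hσ₀, ?_⟩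
  intro σ hσ hσlt T ρ θ u hE Φ h0 t ht hband
  have hK := energyTight_of_tie Φ h0
  have hpt := H σ hσ hσlt T ρ θ u hE Φ h0 t ht hband 2
  have hσ3 : 0 < σ ^ 3 := pow_pos hσ 3
  have hc : 0 < η₁ / σ ^ 3 := div_pos hη₁ hσ3
  refine gridUpgrade a₀ θ₀ u₀ Φ _
    (fun N s => {z | ∃ x : T3, 2 / 3 * η₁ < empiricalDensityField ((Φ N).flow s z)
      (fun y => if Torus.euclidDist x y < 11 / 10 * ((N + 1 : ℕ) : ℝ) ^ (-(1 / 4 : ℝ)) then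
        (4 / 3 * Real.pi * (11 / 10 * ((N + 1 : ℕ) : ℝ) ^ (-(1 / 4 : ℝ))) ^ 3)⁻¹ else 0) * σ ^ 3})
    ht.1 hc hK ?_ hpt
  intro N Δ hΔ hmesh St hSt z hz
  obtain ⟨⟨⟨r, hr, x, hx⟩, hg⟩, hk⟩ := hz
  have hℓ : (0 : ℝ) < ((N + 1 : ℕ) : ℝ) ^ (-(1 / 4 : ℝ)) := Real.rpow_pos_of_pos (by positivity) _
  have hx' : η₁ / σ ^ 3 < empiricalDensityField ((Φ N).flow r z)
      (fun y => if Torus.euclidDist x y < ((N + 1 : ℕ) : ℝ) ^ (-(1 / 4 : ℝ)) then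
        (4 / 3 * Real.pi * (((N + 1 : ℕ) : ℝ) ^ (-(1 / 4 : ℝ))) ^ 3)⁻¹ else 0) :=
    (div_lt_iff₀ hσ3).2 hx
  have hmem := hA (Φ N) t _ _ _ Δ hℓ hc hΔ hmesh St hSt ⟨⟨⟨r, hr, x, hx'⟩, hg⟩, hk⟩
  simp only [mem_iUnion] at hmem ⊢
  obtain ⟨s, hs, y, hy⟩ := hmem
  refine ⟨s, hs, y, ?_⟩
  have hy' : 2 / 3 * η₁ / σ ^ 3 < empiricalDensityField ((Φ N).flow s z)
      (fun y' => if Torus.euclidDist y y' < 11 / 10 * ((N + 1 : ℕ) : ℝ) ^ (-(1 / 4 : ℝ)) then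
        (4 / 3 * Real.pi * (11 / 10 * ((N + 1 : ℕ) : ℝ) ^ (-(1 / 4 : ℝ))) ^ 3)⁻¹ else 0) := by
    rwa [mul_div_assoc]
  exact (div_lt_iff₀ hσ3).1 hy'

/-- **THE SKELETON THEOREM — `EulerCharacteristics.NoDenseInclusions` BY NAME, no hypotheses**: the
composition `noDenseInclusions_of_hyps` applied to the two registered stubs. Its only `sorry`s are the
two stubs (skeleton audit: sorries ⊆ {stub_clockInclusion, stub_fixedTimePackingLD}); it becomes the
crux proof the moment both stubs land. -/
theorem NoDenseInclusions_of : Theses.EulerCharacteristics.NoDenseInclusions :=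
  (noDenseInclusions_of_hyps (fun Ψ t K ℓ c Δ => stub_clockInclusion Ψ t K ℓ c Δ) stub_fixedTimePackingLD).1

/-- The `SuperextensiveClosureCost` twin of the shared item, by name, from the same two stubs. -/
theorem noDenseInclusions_shared_of : Theses.SuperextensiveClosureCost.NoDenseInclusions :=
  (noDenseInclusions_of_hyps (fun Ψ t K ℓ c Δ => stub_clockInclusion Ψ t K ℓ c Δ) stub_fixedTimePackingLD).2

end Summit.AtomisticToContinuum.HydrodynamicLimit.Cruxes.NoDenseInclusions.Birth

end
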